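import Summits.Ventures.CertifiedManyBodySolver.Observables.PairLROTowerWitnessGroundStateSpinDensity
import HarnessLib

/-!
# Half filling, `t' = 0`: the ground-state-complete one-point reading needs NO chemical-potential cover —
# `μc = U/2` is a certified point of the subdifferential `[μ₋(1), μ₊(1)]`

HONEST FRAMING: soundness ("licence") statements for a CEILING route at a CONTROL anchor (half filling, where no
pairing order is expected); a ceiling never speaks to presence; not a superconductivity verdict; no number. Crew
hubbard-obs (D-0042), seat hubbard-obs-gs-2 (`prover-hubbard-obs-gs-2-g3-0`). Zero compute; no definition; no named
fact; no `sorry`.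

The readings `liminf_pairFieldLRO_le_sq_of_groundState_onePoint_bound_at / _spinDensity` take ONE chemical potential
`μc ∈ [μ₋(n), μ₊(n)]`; at generic filling the subdifferential is a point known only through a certified envelope, so a
cover is needed to hit it. At HALF FILLING with `t' = 0` the tree certifies `μ₋(1) ≤ U/2 ≤ μ₊(1)` exactly
(particle–hole symmetry: `chemPotMinusTT'_one_le_half`, `half_le_chemPotPlusTT'_one`), so the half-filled one-point
objects may carry EVERY ground-state row of `H − (U/2)N` (stationarity; all PSD KKT / Nambu blocks) with no cover:

* `half_mem_Icc_chemPot_one` — `U/2 ∈ [μ₋(1), μ₊(1)]` (`U ≥ 0`, any `t`).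
* `liminf_pairFieldLRO_le_sq_of_groundState_onePoint_bound_halfFilling` — a bound `Re ω(Φ₀^g) ≤ M` over
  {translation invariant, `ω(n_{0↑}) = ω(n_{0↓}) = 1/2`, minimiser + Bratteli–Robinson ground state of
  `hubbardTTPrimeMuInteraction t 0 U (U/2)`} gives `liminf_k u_k ≤ M²` for every family of unit
  `(rectN 1 L, S^z = 0)`-sector ground states of `hubbardTorusTT' L t 0 U`;
* `ObsPairLROCeilingAt_halfFilling_of_groundState_onePoint_bound` — the registry leaf `ObsPairLROCeilingAt 0 U 1 c'`
  (`t = 1`, `g = g_d`, `c' ≥ M²`).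

References: T. Koma, H. Tasaki, J. Stat. Phys. 76 (1994) 745–803, Theorem 5 [KomaTasaki1994]; E. H. Lieb, F. Y. Wu,
Physica A 321 (2003) 1–27, §7 (chemical potential at half filling) [LiebWuPhysicaA2003].
-/

noncomputable section

namespace Summit.Ventures.CertifiedManyBodySolver.Observables

open Matrix Complex Finset Literature.MathematicalPhysics.QuantumLattice Literature.Probability.LatticeModels
open Literature.MathematicalPhysics.QuantumLattice.HubbardWave0 ThermodynamicLimit Filter Topology
open scoped ComplexOrder ComplexConjugate BigOperators

/-- **`U/2` lies in the subdifferential at half filling** (`t' = 0`, `U ≥ 0`). [cite: LiebWuPhysicaA2003, §7] -/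
theorem half_mem_Icc_chemPot_one (t : ℝ) {U : ℝ} (hU : 0 ≤ U) :
    U / 2 ∈ Set.Icc (chemPotMinusTT' t 0 U 1) (chemPotPlusTT' t 0 U 1) :=
  ⟨chemPotMinusTT'_one_le_half t hU, half_le_chemPotPlusTT'_one t hU⟩

variable (g : Site 2 → ℝ)

/-- **The ground-state-complete one-point reading at half filling, `t' = 0`, with NO chemical-potential cover**
(`μc = U/2`). [cite: KomaTasaki1994, Theorem 5] [cite: LiebWuPhysicaA2003, §7] -/
theorem liminf_pairFieldLRO_le_sq_of_groundState_onePoint_bound_halfFilling (t : ℝ) {U : ℝ} (hU : 0 ≤ U) {M : ℝ}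
    (hM : ∀ ω : InfVolFermionState 2, ω.IsTranslationInvariant →
      (∀ σ : Fin 2, ω.expect {0} (nAt 0 (Finset.mem_singleton_self 0) σ) = ((((1 : ℝ) / 2 : ℝ)) : ℂ)) →
      ω.IsMeanEnergyMinimiser (hubbardTTPrimeMuInteraction t 0 U (U / 2)) 1 →
      ω.IsGroundState (hubbardTTPrimeMuInteraction t 0 U (U / 2)) 1 →
        (ω.expect (pairRegion (insert (0 : Site 2) unitSteps) 0)
          (localPairAt (insert (0 : Site 2) unitSteps) g 0)).re ≤ M)
    (ψ : ∀ L, Fock (Orb (FermionTorus 2 L)))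
    (hψ : ∀ L, IsGroundStateInSector (hubbardTorusTT' L t 0 U) (rectN 1 L) 0 (ψ L))
    (hψ1 : ∀ L, star (ψ L) ⬝ᵥ ψ L = 1) :
    liminf (fun k : ℕ => (∑ x ∈ halfOpenBox 2 (2 * k), ∑ y ∈ halfOpenBox 2 (2 * k),
        torusPullback (pairFieldCorr g ψ) (2 * k) x y) / ((#(halfOpenBox 2 (2 * k)) : ℝ)) ^ 2) atTop ≤
      M ^ 2 :=
  liminf_pairFieldLRO_le_sq_of_groundState_onePoint_bound_spinDensity g t 0 hU one_pos one_lt_two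
    (half_mem_Icc_chemPot_one t hU) hM ψ hψ hψ1

/-- **Registry consumer at half filling** (`t = 1`, `t' = 0`, `g = g_d`, `μc = U/2`, no cover).
[cite: KomaTasaki1994, Theorem 5] -/
theorem ObsPairLROCeilingAt_halfFilling_of_groundState_onePoint_bound {U : ℝ} (hU : 0 ≤ U) {M : ℝ} {c' : ℚ}
    (hM : ∀ ω : InfVolFermionState 2, ω.IsTranslationInvariant →
      (∀ σ : Fin 2, ω.expect {0} (nAt 0 (Finset.mem_singleton_self 0) σ) = ((((1 : ℝ) / 2 : ℝ)) : ℂ)) →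
      ω.IsMeanEnergyMinimiser (hubbardTTPrimeMuInteraction 1 0 U (U / 2)) 1 →
      ω.IsGroundState (hubbardTTPrimeMuInteraction 1 0 U (U / 2)) 1 →
        (ω.expect (pairRegion (insert (0 : Site 2) unitSteps) 0)
          (localPairAt (insert (0 : Site 2) unitSteps) dWaveFormFactor 0)).re ≤ M)
    (hc' : M ^ 2 ≤ (c' : ℝ)) :
    ObsPairLROCeilingAt 0 U 1 c' :=
  ObsPairLROCeilingAt_of_groundState_onePoint_bound_spinDensity hU one_pos one_lt_two (half_mem_Icc_chemPot_one 1 hU)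
    hM hc'

end Summit.Ventures.CertifiedManyBodySolver.Observables

end
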